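import Mathlib
import Literature.Analysis.FluidPDE.HardSphereCollisionRecord
import Literature.MathematicalPhysics.KineticTheory.HardSphereEuler
import Literature.MathematicalPhysics.KineticTheory.HardSphereEulerProofs
import Summits.AtomisticToContinuum.HydrodynamicLimit.Theorems.OneFlightGossipEngineOneFlightLayeredChaosFirstCollision
import Summits.AtomisticToContinuum.HydrodynamicLimit.Theorems.OneFlightGossipEngineOneFlightLayeredChaosFluxFunctional
import HarnessLib

/-!
# `OneFlightGossipEngine.OneFlightLayeredChaos` — measurability of the pair observables of the first rung
(crux stmt-AtomisticToContinuum-14535, line `Sketch`, serves the stub `stub_firstFlight_flux` — the `n = 0`, fresh-partner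
rung — through the registered stub `measurableSet_firstFlightPairEvent`; stub worker of lead cycle c3, 2026-08-16). Part of the Lean-checked reduction
`FirstFlightVelInput θ₀ → FirstFlightPairInput θ₀ → FirstFlightInput θ₀ → RegimeFluxBody θ₀ ((shortGap θ₀ 0).inter nZero)`
split over the files `…FirstCollision`, `…FluxFunctional`, `…PairMeasurable`, `…FirstFlightInput`,
`…FirstFlightPairInput`, `…FirstFlightVelInput` (grouping namespace `OLC`).

For a fixed pair `(i, j)`: the normalised relative velocity, the free-flight positions at `t₀` and the free-flight contact
normal `ε⁻¹ sepVec (x_i + t₀v_i) (x_j + t₀v_j)` are measurable (on the good set, through the measurable `t₀`); the event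
`{(ĝ, ω) ∈ S}` and the first-flight event of the pair are measurable. No definitions.
-/

open scoped BigOperators ENNReal
open MeasureTheory Set
open Literature.Analysis.FluidPDE Literature.MathematicalPhysics.KineticTheory
open Summit.AtomisticToContinuum.HydrodynamicLimit.Theorems

namespace Summit.AtomisticToContinuum.HydrodynamicLimit.Theorems.OLC

noncomputable section

/-! ## Measurability of the pair quantities -/

section PairMeasurable

variable {σ : ℝ} {N : ℕ} (Φ : HardSphereFlow (Torus.geometry (Fin 3)) (hsDiameter σ N) (N + 1))
  (i : Fin (N + 1))

/-- The normalised relative velocity `(v_i − v_j)/‖v_i − v_j‖` of a fixed pair is a measurable function of the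
configuration. [folklore] -/
theorem measurable_pairDir (j : Fin (N + 1)) :
    Measurable fun z : Config (N + 1) (Fin 3) T3 => ‖(z i).2 - (z j).2‖⁻¹ • ((z i).2 - (z j).2) := by
  have hvk : ∀ k, Measurable fun z : Config (N + 1) (Fin 3) T3 => (z k).2 := fun k =>
    measurable_snd.comp (measurable_pi_apply k)
  exact (((hvk i).sub (hvk j)).norm.inv).smul ((hvk i).sub (hvk j))

/-- The free-flight position `x_k + t₀ v_k` at the first collision time of `i` is measurable on the good set.
[folklore] -/
theorem measurable_freeFlightPos_restrict (k : Fin (N + 1)) :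
    Measurable fun z : Φ.good => (freeFlight (Torus.geometry (Fin 3))
      (Φ.nthCollisionTimeOf i 0 (z : Config (N + 1) (Fin 3) T3)) (z : Config (N + 1) (Fin 3) T3) k).1 := by
  have ht₀m : Measurable fun z : Φ.good => Φ.nthCollisionTimeOf i 0 (z : Config (N + 1) (Fin 3) T3) :=
    measurable_nthCollisionTimeOf_restrict Φ i 0
  have hposk : Measurable fun z : Φ.good => ((z : Config (N + 1) (Fin 3) T3) k).1 :=
    measurable_fst.comp ((measurable_pi_apply k).comp measurable_subtype_coe)
  have hvelk : Measurable fun z : Φ.good => ((z : Config (N + 1) (Fin 3) T3) k).2 :=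
    measurable_snd.comp ((measurable_pi_apply k).comp measurable_subtype_coe)
  show Measurable fun z : Φ.good => ((z : Config (N + 1) (Fin 3) T3) k).1 +
    Literature.Analysis.FunctionSpaces.Torus.proj
      (Φ.nthCollisionTimeOf i 0 (z : Config (N + 1) (Fin 3) T3) • ((z : Config (N + 1) (Fin 3) T3) k).2)
  exact hposk.add (Literature.Analysis.FunctionSpaces.Torus.continuous_proj.measurable.comp (ht₀m.smul hvelk))

/-- The free-flight contact normal `ε⁻¹ sepVec (x_i + t₀ v_i) (x_j + t₀ v_j)` of a fixed pair is measurable on the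
good set. [folklore] -/
theorem measurable_pairNormal_restrict (j : Fin (N + 1)) :
    Measurable fun z : Φ.good => (hsDiameter σ N)⁻¹ • (Torus.geometry (Fin 3)).sepVec
      (freeFlight (Torus.geometry (Fin 3)) (Φ.nthCollisionTimeOf i 0 (z : Config (N + 1) (Fin 3) T3))
        (z : Config (N + 1) (Fin 3) T3) i).1
      (freeFlight (Torus.geometry (Fin 3)) (Φ.nthCollisionTimeOf i 0 (z : Config (N + 1) (Fin 3) T3))
        (z : Config (N + 1) (Fin 3) T3) j).1 :=
  (measurable_const_smul _).comp (Torus.measurable_geometry_sepVec.comp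
    ((measurable_freeFlightPos_restrict Φ i i).prodMk (measurable_freeFlightPos_restrict Φ i j)))

/-- The event `{(ĝ, ω) ∈ S}` of the pair observables is measurable on the good set. [folklore] -/
theorem measurableSet_good_inter_pairObs (j : Fin (N + 1)) {S : Set (V3 × V3)} (hS : MeasurableSet S) :
    MeasurableSet (Φ.good ∩ {z : Config (N + 1) (Fin 3) T3 |
      (‖(z i).2 - (z j).2‖⁻¹ • ((z i).2 - (z j).2),
        (hsDiameter σ N)⁻¹ • (Torus.geometry (Fin 3)).sepVec
          (freeFlight (Torus.geometry (Fin 3)) (Φ.nthCollisionTimeOf i 0 z) z i).1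
          (freeFlight (Torus.geometry (Fin 3)) (Φ.nthCollisionTimeOf i 0 z) z j).1) ∈ S}) :=
  measurableSet_inter_setOf_of_restrict Φ.measurableSet_good
    ((((measurable_pairDir i j).comp measurable_subtype_coe).prodMk (measurable_pairNormal_restrict Φ i j)) hS)

/-- **The first-flight event of a fixed pair is measurable.** [folklore] -/
theorem measurableSet_firstFlightPairEvent : ∀ {σ : ℝ} {N : ℕ} (Φ : Literature.Analysis.FluidPDE.HardSphereFlow (Literature.Analysis.FluidPDE.Torus.geometry (Fin 3)) (Literature.MathematicalPhysics.KineticTheory.hsDiameter σ N) (N + 1)) (i j : Fin (N + 1)) (w : ℝ), MeasurableSet (Φ.good ∩ {z : Literature.Analysis.FluidPDE.Config (N + 1) (Fin 3) Literature.MathematicalPhysics.KineticTheory.T3 | Φ.nthCollisionTimeOf i 0 z ∈ Set.Ioc 0 w ∧ Φ.nthPartnerOf i 0 z = j ∧ ∀ u ∈ Set.Ioo 0 (Φ.nthCollisionTimeOf i 0 z), ¬ Literature.Analysis.FluidPDE.Participates (Literature.Analysis.FluidPDE.Torus.geometry (Fin 3)) (Literature.MathematicalPhysics.KineticTheory.hsDiameter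 σ N) (Φ.flow u z) j}) := by
  intro σ N Φ i j w
  have hF := measurableSet_firstFlightEvent Φ i w
  have hpart : MeasurableSet (Φ.good ∩ {z | Φ.nthPartnerOf i 0 z = j}) :=
    measurableSet_inter_setOf_of_restrict Φ.measurableSet_good
      ((measurable_nthPartnerOf_restrict Φ i 0) (measurableSet_singleton j))
  have heq : (Φ.good ∩ {z : Config (N + 1) (Fin 3) T3 | Φ.nthCollisionTimeOf i 0 z ∈ Ioc 0 w ∧
      Φ.nthPartnerOf i 0 z = j ∧ ∀ u ∈ Ioo 0 (Φ.nthCollisionTimeOf i 0 z),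
        ¬ Participates (Torus.geometry (Fin 3)) (hsDiameter σ N) (Φ.flow u z) j}) =
      (Φ.good ∩ {z : Config (N + 1) (Fin 3) T3 | Φ.nthCollisionTimeOf i 0 z ∈ Ioc 0 w ∧
        ∀ u ∈ Ioo 0 (Φ.nthCollisionTimeOf i 0 z),
          ¬ Participates (Torus.geometry (Fin 3)) (hsDiameter σ N) (Φ.flow u z) (Φ.nthPartnerOf i 0 z)}) ∩
      (Φ.good ∩ {z | Φ.nthPartnerOf i 0 z = j}) := by
    ext z
    constructor
    · rintro ⟨hg, ht, hj, hfr⟩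
      subst hj
      exact ⟨⟨hg, ht, hfr⟩, hg, rfl⟩
    · rintro ⟨⟨hg, ht, hfr⟩, -, hj⟩
      subst hj
      exact ⟨hg, ht, rfl, hfr⟩
  rw [heq]
  exact hF.inter hpart

end PairMeasurable

end

end Summit.AtomisticToContinuum.HydrodynamicLimit.Theorems.OLC
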